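import Mathlib

/-!
# Per-pair exponential clustering does not survive pointwise (even uniform) limits —
# an elementary kernel-checked witness (crux `LatticeGapOnTrajectory`, stmt-QuantumFields-10523)

Lead a1 evidence for the standing verdict on the TRANSFER clause of conjunct (B)
(`… HasLatticeMassGap r sch Δ ∧ ∀ sch' T, IsYangMillsFor r sch' T → T.HasMassGap Δ`).

`HasLatticeMassGap` and `OSData.HasMassGap` are both PER-PAIR clustering statements
(`∀ pair, ∃ C, … ≤ C e^{-Δ t}`), and `IsYangMillsFor` is POINTWISE convergence of the renormalised
lattice Schwinger functions.  The abstract shape of every "transfer" argument that uses only these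
three data is

  (∀ k, ∃ C_k, ∀ t ≥ 0, |S_k t| ≤ C_k e^{-Δ t})  ∧  (∀ t ≥ 0, S_k t → S t)  ⟹  ∃ C, ∀ t ≥ 0, |S t| ≤ C e^{-Δ t},

and this implication is FALSE, even when every `S_k` is an honest "gapped correlator" (a finite
signed combination of `e^{-E t}` with all energies `E ≥ Δ`) and even when the convergence is UNIFORM
in `t`.  Witness (rate `Δ = 1`, limit rate `1/2`):

  `S_k(t) = e^{-t/2} (1 - (1 - e^{-t/2})^k) = Σ_{i=1}^{k} (-1)^{i+1} (k choose i) e^{-(i+1)t/2}`,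
  `0 ≤ S_k(t) ≤ k e^{-t}`,  `|S_k(t) - e^{-t/2}| ≤ 1/k`,  and `e^{-t/2}` is not `O(e^{-t})`.

So a proof of the transfer clause must use MORE than per-pair constants: the k-UNIFORM quantity that
transfers is reflection positivity (spectral measures of OS-DIAGONAL pairs are positive, their total
mass is a convergent Schwinger function), which is why the repaired bridge in the tree
(`…TransferFromOSGapSlack`, p96292) needs the lattice half in OS currency and REFLECTION-SYMMETRIC
witness renormalisations `sch'` (for a non-symmetric species `s` the `T`-diagonal pair is the
lattice OFF-diagonal pair `(s ∘ Θ₀, s)`, whose spectral measure is signed with variation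
`∝ c_s(k) / c_{s∘Θ₀}(k)`, unconstrained by `IsYangMillsFor r sch' T`).

Everything below is over Mathlib only (no project imports); `lean check`: rc 0, 0 sorries.
-/

namespace Summit.QuantumFields.YangMills.Cruxes.LatticeGapOnTrajectory.TransferObstruction

open Filter Topology Finset

/-- The `k`-th model correlator `S_k(t) = e^{-t/2} (1 - (1 - e^{-t/2})^k)`. -/
noncomputable def S (k : ℕ) (t : ℝ) : ℝ :=
  Real.exp (-t / 2) * (1 - (1 - Real.exp (-t / 2)) ^ k)

/-- Abbreviation: `x(t) = e^{-t/2} ∈ (0, 1]` for `t ≥ 0`. -/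
theorem exp_half_mem {t : ℝ} (ht : 0 ≤ t) :
    0 < Real.exp (-t / 2) ∧ Real.exp (-t / 2) ≤ 1 := by
  refine ⟨Real.exp_pos _, ?_⟩
  have : -t / 2 ≤ 0 := by linarith
  simpa using Real.exp_le_one_iff.mpr this

/-- `S_k ≥ 0` on `t ≥ 0`. -/
theorem S_nonneg (k : ℕ) {t : ℝ} (ht : 0 ≤ t) : 0 ≤ S k t := by
  obtain ⟨hx0, hx1⟩ := exp_half_mem ht
  unfold S
  refine mul_nonneg hx0.le ?_
  have h1 : 0 ≤ 1 - Real.exp (-t / 2) := by linarith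
  have h2 : 1 - Real.exp (-t / 2) ≤ 1 := by linarith
  have : (1 - Real.exp (-t / 2)) ^ k ≤ 1 := pow_le_one₀ h1 h2
  linarith

/-- **Per-`k` clustering at rate `1`** (the shape of `HasLatticeMassGap`, constant `C_k = k`):
`|S_k(t)| ≤ k · e^{-t}` for `t ≥ 0` (Bernoulli: `1 - (1-x)^k ≤ k x`). -/
theorem S_clusters (k : ℕ) : ∃ C : ℝ, ∀ t : ℝ, 0 ≤ t → |S k t| ≤ C * Real.exp (-t) := by
  refine ⟨k, fun t ht => ?_⟩
  obtain ⟨hx0, hx1⟩ := exp_half_mem ht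
  set x := Real.exp (-t / 2) with hx
  have hexp : Real.exp (-t) = x * x := by
    rw [hx, ← Real.exp_add]; congr 1; ring
  rw [abs_of_nonneg (S_nonneg k ht), hexp]
  unfold S
  rw [← hx]
  -- Bernoulli: (1 - x)^k ≥ 1 - k x
  have hB : 1 - (k : ℝ) * x ≤ (1 - x) ^ k := by
    have h := one_add_mul_le_pow (a := -x) (by linarith) k
    simpa [sub_eq_add_neg, mul_comm] using h
  have h1 : 1 - (1 - x) ^ k ≤ (k : ℝ) * x := by linarith
  calc x * (1 - (1 - x) ^ k) ≤ x * ((k : ℝ) * x) := mul_le_mul_of_nonneg_left h1 hx0.le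
    _ = (k : ℝ) * (x * x) := by ring

/-- **Each `S_k` is a genuine gapped correlator**: a finite signed combination of exponentials
`e^{-E t}` with energies `E = (i+1)/2 ≥ 1`, `i = 1, …, k` (binomial expansion). -/
theorem S_eq_sum (k : ℕ) (t : ℝ) :
    S k t = ∑ i ∈ range (k + 1) with 1 ≤ i,
      ((-1 : ℝ) ^ (i + 1) * (k.choose i : ℝ)) * Real.exp (-(((i : ℝ) + 1) / 2) * t) := by
  set x := Real.exp (-t / 2) with hx
  have hpow : ∀ i : ℕ, Real.exp (-(((i : ℝ) + 1) / 2) * t) = x ^ (i + 1) := by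
    intro i
    rw [hx, ← Real.exp_nat_mul]; congr 1; push_cast; ring
  simp_rw [hpow]
  -- binomial theorem for (1 - x)^k = ((-x) + 1)^k
  have hbin : (1 - x) ^ k = ∑ i ∈ range (k + 1), (-x) ^ i * (k.choose i : ℝ) := by
    have h := add_pow (-x) 1 k
    simp only [one_pow, mul_one] at h
    rw [show (1 : ℝ) - x = -x + 1 by ring, h]
  unfold S
  rw [← hx, hbin, Finset.sum_filter]
  -- split off the `i = 0` term of the binomial sum
  rw [Finset.sum_range_succ', Finset.sum_range_succ']
  simp only [pow_zero, Nat.choose_zero_right, Nat.cast_one, mul_one, le_add_iff_nonneg_left,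
    zero_le, ↓reduceIte, nonpos_iff_eq_zero, one_ne_zero, add_zero]
  rw [show (1 : ℝ) - (∑ i ∈ range k, (-x) ^ (i + 1) * (k.choose (i + 1) : ℝ) + 1) =
      -∑ i ∈ range k, (-x) ^ (i + 1) * (k.choose (i + 1) : ℝ) by ring]
  rw [mul_neg, Finset.mul_sum, ← Finset.sum_neg_distrib]
  refine Finset.sum_congr rfl fun i _ => ?_
  rw [neg_pow]
  ring

/-- **Pointwise convergence** (the shape of `IsYangMillsFor`): for every `t ≥ 0`,
`S_k(t) → e^{-t/2}`. -/
theorem S_tendsto {t : ℝ} (ht : 0 ≤ t) :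
    Tendsto (fun k => S k t) atTop (𝓝 (Real.exp (-t / 2))) := by
  obtain ⟨hx0, hx1⟩ := exp_half_mem ht
  have h0 : 0 ≤ 1 - Real.exp (-t / 2) := by linarith
  have h1 : 1 - Real.exp (-t / 2) < 1 := by linarith
  have hp : Tendsto (fun k : ℕ => (1 - Real.exp (-t / 2)) ^ k) atTop (𝓝 0) :=
    tendsto_pow_atTop_nhds_zero_of_lt_one h0 h1
  have : Tendsto (fun k : ℕ => Real.exp (-t / 2) * (1 - (1 - Real.exp (-t / 2)) ^ k)) atTop
      (𝓝 (Real.exp (-t / 2) * (1 - 0))) :=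
    tendsto_const_nhds.mul (tendsto_const_nhds.sub hp)
  simpa [S] using this

/-- **The convergence is even UNIFORM in `t ≥ 0`**: `|S_k(t) - e^{-t/2}| ≤ 1/k`
(`x (1-x)^k ≤ x / (1 + k x) ≤ 1/k` on `[0,1]`, from `(1-x)^k (1 + k x) ≤ (1 - x²)^k ≤ 1`). -/
theorem S_uniform (k : ℕ) (hk : 1 ≤ k) {t : ℝ} (ht : 0 ≤ t) :
    |S k t - Real.exp (-t / 2)| ≤ 1 / k := by
  obtain ⟨hx0, hx1⟩ := exp_half_mem ht
  set x := Real.exp (-t / 2) with hx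
  have hk0 : (0 : ℝ) < k := by exact_mod_cast hk
  have hdiff : S k t - x = -(x * (1 - x) ^ k) := by unfold S; rw [← hx]; ring
  rw [hdiff, abs_neg]
  have h1x : 0 ≤ 1 - x := by linarith
  have hpow_nonneg : 0 ≤ (1 - x) ^ k := pow_nonneg h1x k
  rw [abs_of_nonneg (mul_nonneg hx0.le hpow_nonneg)]
  -- (1 - x)^k * (1 + k x) ≤ ((1 - x) * (1 + x))^k ≤ 1
  have hB : 1 + (k : ℝ) * x ≤ (1 + x) ^ k := by
    have h := one_add_mul_le_pow (a := x) (by linarith) k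
    simpa [mul_comm] using h
  have hprod : (1 - x) ^ k * (1 + (k : ℝ) * x) ≤ 1 := by
    calc (1 - x) ^ k * (1 + (k : ℝ) * x) ≤ (1 - x) ^ k * (1 + x) ^ k :=
          mul_le_mul_of_nonneg_left hB hpow_nonneg
      _ = ((1 - x) * (1 + x)) ^ k := by rw [mul_pow]
      _ ≤ 1 ^ k := by
          apply pow_le_pow_left₀ (mul_nonneg h1x (by linarith))
          nlinarith
      _ = 1 := one_pow k
  -- hence x (1-x)^k (1 + k x) ≤ x ≤ (1 + k x)/k
  have hden : 0 < 1 + (k : ℝ) * x := by positivity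
  rw [le_div_iff₀ hk0]
  have : x * (1 - x) ^ k * (1 + (k : ℝ) * x) ≤ x := by
    calc x * (1 - x) ^ k * (1 + (k : ℝ) * x) = x * ((1 - x) ^ k * (1 + (k : ℝ) * x)) := by ring
      _ ≤ x * 1 := mul_le_mul_of_nonneg_left hprod hx0.le
      _ = x := mul_one x
  nlinarith [mul_nonneg hx0.le hpow_nonneg]

/-- **The limit is NOT gapped at rate `1`**: `e^{-t/2}` admits no bound `C e^{-t}` on `t ≥ 0`. -/
theorem limit_not_clustered : ¬ ∃ C : ℝ, ∀ t : ℝ, 0 ≤ t → |Real.exp (-t / 2)| ≤ C * Real.exp (-t) := by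
  rintro ⟨C, hC⟩
  -- at t = 2 (|C| + 1): e^{|C|+1} ≤ C
  set t : ℝ := 2 * (|C| + 1) with ht
  have ht0 : 0 ≤ t := by rw [ht]; positivity
  have h := hC t ht0
  rw [abs_of_pos (Real.exp_pos _)] at h
  have hmul : Real.exp (-t / 2) * Real.exp t ≤ C * Real.exp (-t) * Real.exp t :=
    mul_le_mul_of_nonneg_right h (Real.exp_pos t).le
  rw [mul_assoc, ← Real.exp_add, ← Real.exp_add] at hmul
  have h1 : -t / 2 + t = |C| + 1 := by rw [ht]; ring
  have h2 : -t + t = 0 := by ring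
  rw [h1, h2, Real.exp_zero, mul_one] at hmul
  have h3 : |C| + 1 + 1 ≤ Real.exp (|C| + 1) := Real.add_one_le_exp _
  have h4 : C ≤ |C| := le_abs_self C
  linarith

/-- **Summary (the abstract transfer principle behind the crux's second conjunct is false).**
There is a sequence of functions, each clustering at rate `1` with its own constant and each a
finite signed sum of exponentials with energies `≥ 1`, converging for every `t ≥ 0` (indeed
uniformly) to a limit that does not cluster at rate `1`. -/
theorem perPair_clustering_does_not_transfer :
    ∃ (F : ℕ → ℝ → ℝ) (L : ℝ → ℝ),
      (∀ k, ∃ C : ℝ, ∀ t : ℝ, 0 ≤ t → |F k t| ≤ C * Real.exp (-t)) ∧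
      (∀ t : ℝ, 0 ≤ t → Tendsto (fun k => F k t) atTop (𝓝 (L t))) ∧
      (∀ k : ℕ, 1 ≤ k → ∀ t : ℝ, 0 ≤ t → |F k t - L t| ≤ 1 / k) ∧
      ¬ ∃ C : ℝ, ∀ t : ℝ, 0 ≤ t → |L t| ≤ C * Real.exp (-t) :=
  ⟨S, fun t => Real.exp (-t / 2), S_clusters, fun _ ht => S_tendsto ht,
    fun k hk _ ht => S_uniform k hk ht, limit_not_clustered⟩

end Summit.QuantumFields.YangMills.Cruxes.LatticeGapOnTrajectory.TransferObstruction
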